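import Literature.Barriers.CriticalPhenomena.LongRangeTrivialityOnZ3Field

/-!
# The long-range Ising model on the discrete torus `𝕋_N = (ℤ/Nℤ)^d` with the periodised coupling
# `J^{(N)}_{x,y} = ∑_z J_{x,y+Nz}` (Panis 2023, §3.1): Gibbs state, GKS, translation and flip
# symmetry, and Griffiths' comparison `⟨σ_A⟩^free_Λ ≤ ⟨σ_A⟩_{𝕋_N}`

Sibling of `Literature/Barriers/CriticalPhenomena/LongRangeTrivialityOnZ3.lean` (barrier catalogue
D-0021, sub-problem `Ising3DConformalLimit`), first file of the TORUS ROUTE to the infrared bound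
`panis_infraredBound_algebraic` (Panis 2023, arXiv:2309.05797, Proposition 3.8 / §3.6) for the
algebraically decaying couplings `J_{x,y} = C₀|x-y|₁^{-d-α}`: Panis §3.1 puts the interaction on the
torus ("If `J = (J_{x,y})`, we can view it as an interaction `J^{(L)}` on `𝕋_L` by setting
`J^{(L)}_{x,y} := ∑_{z∈ℤ^d} J_{x,y+Lz}`"), proves the infrared bound there (Proposition 3.4, Gaussian
domination) and transfers it to `ℤ^d`. This file sets up the torus side:

* `torusLift N a ∈ [0,N)^d` (the representative of a torus site), the fundamental cube
  `halfOpenBox d N` and `cubeEquivTorus N : ↥(halfOpenBox d N) ≃ 𝕋_N`;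
* `torusCoupling J N a b = J^{(N)}_{a,b} = ∑'_z J_{ã, b̃+Nz}` (the printed periodisation, with the
  representatives `ã = torusLift N a`) and `cubeCoupling J N a b = J_{ã,b̃}` (the free cube model
  transported to the torus); `J_{ã,b̃} ≤ J^{(N)}_{a,b}` (the `z = 0` term) and translation
  invariance of `J^{(N)}` on `𝕋_N` for translation-invariant `J`;
* the finite-volume Gibbs state `torusExpect c β h` on `𝕋_N` of a general pair-coupling matrix `c`
  in a field `h` (`H = -½∑_{a,b}c_{a,b}σ_aσ_b - h∑_aσ_a`; Panis's `⟨·⟩_{𝕋_L,J^{(L)},β}` is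
  `c = torusCoupling J L`), identified with the spin system `ν_{Λ;K}` of Friedli–Velenik §3.8.1
  (`torusExpect_eq_gksExpect`), whence GKS I, Griffiths' comparison in the coupling matrix and in
  the field; its translation invariance (`torusExpect_spinProduct_image_addRight`) and spin-flip
  symmetry at `h = 0` (`torusExpect_comp_neg`);
* the transport identity `⟨σ_A⟩^free_{[0,N)^d,J,h,β} = ⟨σ_{Ā}⟩_{𝕋_N,cubeCoupling,h,β}`
  (`expectIn_halfOpenBox_spinProduct_eq`) and **Griffiths' comparison of the free box with the
  torus**, `⟨σ_A⟩^free_{Λ_n,J,h,β} ≤ ⟨σ_{Ā}⟩_{𝕋_N,J^{(N)},h,β}` for `2n+1 ≤ N`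
  (`expectIn_box_spinProduct_le_torusExpect`; GKS II: the torus carries more couplings), the
  long-range analogue of `isingTwoPoint_free_box_le_torus` of the nearest-neighbour tree
  (`LroInfraredBound.lean`, ADS15 (3.19)).

Everything is PROVED; all sums over configurations are finite. Hypotheses are carried explicitly:
`J ≥ 0`, translation invariance `J_{x+a,y+a} = J_{x,y}`, summability of `J_{0,·}` where the
periodisation is summed.

## References

* R. Panis, arXiv:2309.05797 (2023) = Ann. Probab. 54 (2026), §3.1 (the torus `𝕋_L`, `J^{(L)}`,
  Definition 3.1), §3.3 (Prop. 3.4) [Panis2023Triviality] (held; read pp. 13–16).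
* S. Friedli, Y. Velenik, *Statistical Mechanics of Lattice Systems*, CUP (2017), §3.8.1
  (Thm. 3.49, Exercises 3.12, 3.30, 3.31) [FriedliVelenik2017].
* M. Aizenman, H. Duminil-Copin, V. Sidoravicius, CMP 334 (2015), §3.3 eq. (3.19) (the comparison
  free box ≤ torus, nearest-neighbour case) [AizenmanDuminilCopinSidoraviciusCMP2015].
-/

noncomputable section

namespace Literature.Barriers.CriticalPhenomena

open Literature.Probability.LatticeModels Literature.Probability.Percolation Filter Topology Finset
open scoped symmDiff

namespace LongRangeIsing

variable {d : ℕ}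

/-! ### Torus geometry: representatives and the fundamental cube `[0,N)^d` -/

section TorusGeometry

variable (N : ℕ)

/-- The representative `ã ∈ [0,N)^d ⊂ ℤ^d` of a torus site `a ∈ (ℤ/Nℤ)^d` (coordinatewise
`ZMod.val`). [cite: Panis2023Triviality, §3.1 (the torus 𝕋_L = (ℤ/Lℤ)^d)] -/
def torusLift (a : TorusSite d N) : Site d := fun i => ((a i).val : ℤ)

/-- `ã` projects back to `a`. [folklore] -/
@[simp] theorem proj_torusLift [NeZero N] (a : TorusSite d N) : Torus.proj N (torusLift N a) = a := by
  funext i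
  simp [torusLift, Torus.proj]

/-- `ã ∈ [0,N)^d`. [folklore] -/
theorem torusLift_mem_halfOpenBox [NeZero N] (a : TorusSite d N) : torusLift N a ∈ halfOpenBox d N := by
  rw [mem_halfOpenBox]
  intro i
  refine ⟨Int.natCast_nonneg _, ?_⟩
  show (((a i).val : ℕ) : ℤ) < (N : ℤ)
  exact_mod_cast ZMod.val_lt (a i)

/-- On the fundamental cube the lift inverts the projection. [folklore] -/
theorem torusLift_proj [NeZero N] {x : Site d} (hx : x ∈ halfOpenBox d N) : torusLift N (Torus.proj N x) = x := by
  rw [mem_halfOpenBox] at hx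
  funext i
  simp only [torusLift, Torus.proj_apply]
  rw [ZMod.val_intCast, Int.emod_eq_of_lt (hx i).1 (hx i).2]

/-- The lift is injective. [folklore] -/
theorem torusLift_injective [NeZero N] : Function.Injective (torusLift (d := d) N) := by
  intro a b h
  rw [← proj_torusLift N a, h, proj_torusLift]

/-- Two lattice points have the same projection iff they differ by an element of `Nℤ^d`. [folklore] -/
theorem proj_eq_proj_iff (x y : Site d) : Torus.proj N x = Torus.proj N y ↔ ∃ z : Site d, y = x + (N : ℤ) • z := by
  constructor
  · intro h
    have hc : ∀ i, ∃ k : ℤ, y i - x i = (N : ℤ) * k := by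
      intro i
      have hi : (x i : ZMod N) = (y i : ZMod N) := by simpa using congrFun h i
      exact (ZMod.intCast_eq_intCast_iff_dvd_sub (x i) (y i) N).1 hi
    choose k hk using hc
    refine ⟨fun i => k i, funext fun i => ?_⟩
    simp only [Pi.add_apply, Pi.smul_apply, smul_eq_mul]
    linarith [hk i]
  · rintro ⟨z, rfl⟩
    funext i
    simp [Torus.proj]

/-- `x̃̄ = x + Nz` for some `z`: the lift of the projection differs from `x` by an element of
`Nℤ^d`. [folklore] -/
theorem exists_torusLift_proj_eq [NeZero N] (x : Site d) : ∃ z : Site d, torusLift N (Torus.proj N x) = x + (N : ℤ) • z :=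
  (proj_eq_proj_iff N x _).1 (by rw [proj_torusLift])

/-- The fundamental cube `[0,N)^d` is in bijection with the torus (projection / lift).
[cite: Panis2023Triviality, §3.1 (𝕋_L)] -/
def cubeEquivTorus [NeZero N] : ↥(halfOpenBox d N) ≃ TorusSite d N where
  toFun z := Torus.proj N z
  invFun a := ⟨torusLift N a, torusLift_mem_halfOpenBox N a⟩
  left_inv z := Subtype.ext (torusLift_proj N z.2)
  right_inv a := proj_torusLift N a

/-- The cube-to-torus bijection is the projection. [folklore] -/
@[simp] theorem cubeEquivTorus_apply [NeZero N] (z : ↥(halfOpenBox d N)) : cubeEquivTorus N z = Torus.proj N z := rfl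

/-- Its inverse is the lift. [folklore] -/
@[simp] theorem cubeEquivTorus_symm_apply [NeZero N] (a : TorusSite d N) :
    ((cubeEquivTorus N).symm a : Site d) = torusLift N a := rfl

end TorusGeometry

/-! ### The periodised coupling `J^{(N)}` and the transported free coupling -/

section Periodized

variable (J : Site d → Site d → ℝ) (N : ℕ)

/-- **Panis's periodised interaction on the torus**: `J^{(N)}_{a,b} := ∑_{z∈ℤ^d} J_{ã, b̃+Nz}` with
`ã, b̃ ∈ [0,N)^d` the representatives (a `tsum`; `0` if not summable).
[cite: Panis2023Triviality, §3.1 (J^{(L)}_{x,y} := ∑_{z∈ℤ^d} J_{x,y+Lz})] -/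
def torusCoupling (a b : TorusSite d N) : ℝ :=
  ∑' z : Site d, J (torusLift N a) (torusLift N b + (N : ℤ) • z)

/-- The free model on the cube `[0,N)^d` transported to the torus: `c_{a,b} = J_{ã,b̃}`. [folklore] -/
def cubeCoupling (a b : TorusSite d N) : ℝ :=
  J (torusLift N a) (torusLift N b)

/-- `z ↦ y + Nz` is injective for `N ≠ 0`. [folklore] -/
theorem add_smul_injective [NeZero N] (y : Site d) : Function.Injective fun z : Site d => y + (N : ℤ) • z := by
  intro z w h
  have h' : (N : ℤ) • z = (N : ℤ) • w := add_left_cancel h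
  funext i
  have hi := congrFun h' i
  simp only [Pi.smul_apply, smul_eq_mul] at hi
  exact mul_left_cancel₀ (by exact_mod_cast NeZero.ne N) hi

/-- For translation-invariant `J` with `J_{0,·}` summable, `z ↦ J_{x,y+Nz}` is summable (`N ≠ 0`).
[folklore] -/
theorem summable_coupling_add_smul (hJt : ∀ a x y, J (x + a) (y + a) = J x y) (hJs : Summable (J 0))
    [NeZero N] (x y : Site d) : Summable fun z : Site d => J x (y + (N : ℤ) • z) := by
  have h1 : Summable (J x) := by
    have e : J x = fun w => J 0 (w + -x) := by
      funext w
      rw [← hJt (-x) x w, add_neg_cancel]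
    rw [e]
    exact (Equiv.addRight (-x)).summable_iff.2 hJs
  exact h1.comp_injective (add_smul_injective N y)

/-- `J^{(N)} ≥ 0` for `J ≥ 0`. [folklore] -/
theorem torusCoupling_nonneg (hJ : ∀ x y, 0 ≤ J x y) (a b : TorusSite d N) : 0 ≤ torusCoupling J N a b :=
  tsum_nonneg fun _ => hJ _ _

/-- `J ≥ 0` transported: `cubeCoupling ≥ 0`. [folklore] -/
theorem cubeCoupling_nonneg (hJ : ∀ x y, 0 ≤ J x y) (a b : TorusSite d N) : 0 ≤ cubeCoupling J N a b := hJ _ _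

/-- **The torus carries more couplings than the free cube**: `J_{ã,b̃} ≤ J^{(N)}_{a,b}` (the term
`z = 0` of the periodisation). [cite: Panis2023Triviality, §3.1 (J^{(L)})] -/
theorem cubeCoupling_le_torusCoupling (hJ : ∀ x y, 0 ≤ J x y) (hJt : ∀ a x y, J (x + a) (y + a) = J x y)
    (hJs : Summable (J 0)) [NeZero N] (a b : TorusSite d N) : cubeCoupling J N a b ≤ torusCoupling J N a b := by
  have hs := summable_coupling_add_smul J N hJt hJs (torusLift N a) (torusLift N b)
  have h := hs.le_tsum (0 : Site d) fun z _ => hJ _ _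
  simpa [cubeCoupling, torusCoupling] using h

/-- `Torus.proj` is additive. [folklore] -/
theorem proj_add_eq (x y : Site d) : Torus.proj N (x + y) = Torus.proj N x + Torus.proj N y := by
  funext i; simp [Torus.proj]

/-- The lift of a sum: `(a+t)~ = ã + t̃ + Nu` for some `u ∈ ℤ^d`. [folklore] -/
theorem exists_torusLift_add_eq [NeZero N] (a t : TorusSite d N) :
    ∃ u : Site d, torusLift N (a + t) = torusLift N a + torusLift N t + (N : ℤ) • u :=
  (proj_eq_proj_iff N _ _).1 (by rw [proj_add_eq, proj_torusLift, proj_torusLift, proj_torusLift])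

/-- **`J^{(N)}` is translation invariant on the torus** for translation-invariant `J`:
`J^{(N)}_{a+t,b+t} = J^{(N)}_{a,b}`. [cite: Panis2023Triviality, §3.1 (J^{(L)}; (A3) translation invariance)] -/
theorem torusCoupling_add_right (hJt : ∀ a x y, J (x + a) (y + a) = J x y) [NeZero N] (a b t : TorusSite d N) :
    torusCoupling J N (a + t) (b + t) = torusCoupling J N a b := by
  obtain ⟨u, hu⟩ := exists_torusLift_add_eq N a t
  obtain ⟨v, hv⟩ := exists_torusLift_add_eq N b t
  rw [torusCoupling, torusCoupling, hu, hv]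
  have key : ∀ z : Site d, J (torusLift N a + torusLift N t + (N : ℤ) • u) (torusLift N b + torusLift N t + (N : ℤ) • v + (N : ℤ) • z) =
      J (torusLift N a) (torusLift N b + (N : ℤ) • (z + (v - u))) := by
    intro z
    rw [← hJt (torusLift N t + (N : ℤ) • u) (torusLift N a) (torusLift N b + (N : ℤ) • (z + (v - u)))]
    congr 1
    · abel
    · simp only [smul_add, smul_sub]
      abel
  simp_rw [key]
  exact (Equiv.addRight (v - u)).tsum_eq fun z => J (torusLift N a) (torusLift N b + (N : ℤ) • z)

/-- `J^{(N)}_{a,b}` only depends on `b - a` (translation invariance, one-variable form). [folklore] -/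
theorem torusCoupling_eq_zero_sub (hJt : ∀ a x y, J (x + a) (y + a) = J x y) [NeZero N] (a b : TorusSite d N) :
    torusCoupling J N a b = torusCoupling J N 0 (b - a) := by
  have h := torusCoupling_add_right J N hJt 0 (b - a) a
  rw [zero_add, sub_add_cancel] at h
  exact h

end Periodized

/-! ### The Gibbs state of a pair-coupling matrix on the torus, in a field -/

section TorusGibbs

variable {N : ℕ} [NeZero N] (c : TorusSite d N → TorusSite d N → ℝ) (β h : ℝ)

/-- The torus Hamiltonian `H_{𝕋_N,c,h}(σ) = -½∑_{a,b}c_{a,b}σ_aσ_b - h∑_aσ_a` (ordered double sum; the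
diagonal contributes a constant). [cite: Panis2023Triviality, §1.2.1 (H_{Λ,J,h}) and §3.1 (⟨·⟩_{𝕋_L,ρ,J^{(L)},β})] -/
def torusHamiltonian (σ : SpinConfig (TorusSite d N)) : ℝ :=
  -(∑ a, ∑ b, c a b * spinAt a σ * spinAt b σ) / 2 - h * ∑ a, spinAt a σ

/-- The Boltzmann weight `exp[-βH_{𝕋_N,c,h}(σ)]`. [cite: Panis2023Triviality, §3.1 (⟨·⟩_{𝕋_L,ρ,β})] -/
def torusWeight (σ : SpinConfig (TorusSite d N)) : ℝ :=
  Real.exp (-β * torusHamiltonian c h σ)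

/-- The torus partition function `Z(𝕋_N,c,h,β) = ∑_σ exp[-βH(σ)]`. [cite: Panis2023Triviality, §1.2.1 (Z(Λ,J,h,β))] -/
def torusPartition : ℝ := ∑ σ : SpinConfig (TorusSite d N), torusWeight c β h σ

/-- **The torus Gibbs state** `⟨F⟩_{𝕋_N,c,h,β} = Z⁻¹∑_σ F(σ)exp[-βH(σ)]`; Panis's
`⟨·⟩_{𝕋_L,ρ,β} = ⟨·⟩_{𝕋_L,ρ,J^{(L)},β}` (Ising spins) is `c = torusCoupling J L`.
[cite: Panis2023Triviality, Definition 3.1 (⟨·⟩_{𝕋_L,ρ,β} = ⟨·⟩_{𝕋_L,ρ,J^{(L)},β})] -/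
def torusExpect (F : SpinConfig (TorusSite d N) → ℝ) : ℝ :=
  (∑ σ : SpinConfig (TorusSite d N), F σ * torusWeight c β h σ) / torusPartition c β h

/-- Boltzmann weights are positive. [folklore] -/
theorem torusWeight_pos (σ : SpinConfig (TorusSite d N)) : 0 < torusWeight c β h σ := Real.exp_pos _

/-- `Z > 0`. [folklore] -/
theorem torusPartition_pos : 0 < torusPartition c β h :=
  Finset.sum_pos (fun σ _ => torusWeight_pos c β h σ) Finset.univ_nonempty

/-- Additivity. [folklore] -/
theorem torusExpect_add (F G : SpinConfig (TorusSite d N) → ℝ) :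
    torusExpect c β h (fun σ => F σ + G σ) = torusExpect c β h F + torusExpect c β h G := by
  simp only [torusExpect, add_mul, Finset.sum_add_distrib, add_div]

/-- Homogeneity. [folklore] -/
theorem torusExpect_const_mul (r : ℝ) (F : SpinConfig (TorusSite d N) → ℝ) :
    torusExpect c β h (fun σ => r * F σ) = r * torusExpect c β h F := by
  simp only [torusExpect, mul_assoc, ← Finset.mul_sum, mul_div_assoc]

/-- Finite sums. [folklore] -/
theorem torusExpect_finset_sum {ι : Type*} (s : Finset ι) (F : ι → SpinConfig (TorusSite d N) → ℝ) :
    torusExpect c β h (fun σ => ∑ i ∈ s, F i σ) = ∑ i ∈ s, torusExpect c β h (F i) := by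
  simp only [torusExpect, torusPartition, Finset.sum_mul, Finset.sum_div]
  exact Finset.sum_comm

/-- `⟨r⟩ = r`. [folklore] -/
theorem torusExpect_const (r : ℝ) : torusExpect c β h (fun _ => r) = r := by
  rw [torusExpect, ← Finset.mul_sum, mul_div_assoc]
  change r * (torusPartition c β h / torusPartition c β h) = r
  rw [div_self (torusPartition_pos c β h).ne', mul_one]

/-- Positivity. [folklore] -/
theorem torusExpect_nonneg {F : SpinConfig (TorusSite d N) → ℝ} (hF : ∀ σ, 0 ≤ F σ) : 0 ≤ torusExpect c β h F :=
  div_nonneg (Finset.sum_nonneg fun σ _ => mul_nonneg (hF _) (torusWeight_pos c β h σ).le) (torusPartition_pos c β h).le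

/-- Monotonicity. [folklore] -/
theorem torusExpect_mono {F G : SpinConfig (TorusSite d N) → ℝ} (hFG : ∀ σ, F σ ≤ G σ) :
    torusExpect c β h F ≤ torusExpect c β h G := by
  have h1 : torusExpect c β h G - torusExpect c β h F = torusExpect c β h (fun σ => G σ - F σ) := by
    simp only [torusExpect, sub_mul, Finset.sum_sub_distrib, sub_div]
  have h2 : 0 ≤ torusExpect c β h (fun σ => G σ - F σ) := torusExpect_nonneg c β h fun σ => sub_nonneg.2 (hFG σ)
  linarith

/-- `|⟨F⟩| ≤ 1` for `|F| ≤ 1`. [folklore] -/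
theorem abs_torusExpect_le_one {F : SpinConfig (TorusSite d N) → ℝ} (hF : ∀ σ, |F σ| ≤ 1) :
    |torusExpect c β h F| ≤ 1 := by
  rw [abs_le]
  constructor
  · have h1 := torusExpect_mono c β h (F := fun _ => (-1 : ℝ)) (G := F) fun σ => (abs_le.1 (hF σ)).1
    rwa [torusExpect_const] at h1
  · have h1 := torusExpect_mono c β h (F := F) (G := fun _ => (1 : ℝ)) fun σ => (abs_le.1 (hF σ)).2
    rwa [torusExpect_const] at h1

/-! #### Bridge to the spin systems `ν_{Λ;K}` of Friedli–Velenik §3.8.1 -/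

/-- **The energy identity**: with couplings `K_{(a,b)} = (β/2)c_{a,b}` on ordered pairs (supports
`{a} ∆ {b}`) and `K_a = βh` on sites, `∑ᵢ Kᵢσ_{Cᵢ} = -βH_{𝕋_N,c,h}(σ)`. [cite: FriedliVelenik2017, §3.8.1, p. 141] -/
theorem gksHamiltonian_torus (σ : SpinConfig (TorusSite d N)) :
    gksHamiltonian (univ : Finset ((TorusSite d N × TorusSite d N) ⊕ TorusSite d N))
        (Sum.elim (fun p : TorusSite d N × TorusSite d N => β / 2 * c p.1 p.2) fun _ => β * h)
        (Sum.elim (fun p : TorusSite d N × TorusSite d N => {p.1} ∆ {p.2}) fun a => {a}) σ =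
      -β * torusHamiltonian c h σ := by
  rw [gksHamiltonian, Fintype.sum_sum_type, Fintype.sum_prod_type]
  simp only [Sum.elim_inl, Sum.elim_inr]
  simp_rw [← spinAt_mul_spinAt_eq_spinProduct, spinProduct_singleton_eq_spinAt]
  have e : -β * torusHamiltonian c h σ =
      β / 2 * (∑ a, ∑ b, c a b * spinAt a σ * spinAt b σ) + β * h * ∑ a, spinAt a σ := by
    rw [torusHamiltonian]; ring
  rw [e, Finset.mul_sum, Finset.mul_sum]
  congr 1
  refine Finset.sum_congr rfl fun a _ => ?_
  rw [Finset.mul_sum]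
  exact Finset.sum_congr rfl fun b _ => by ring

/-- The Boltzmann weight is the weight of `ν_{Λ;K}`. [folklore] -/
theorem torusWeight_eq_gksWeight (σ : SpinConfig (TorusSite d N)) :
    torusWeight c β h σ =
      gksWeight (univ : Finset ((TorusSite d N × TorusSite d N) ⊕ TorusSite d N))
        (Sum.elim (fun p : TorusSite d N × TorusSite d N => β / 2 * c p.1 p.2) fun _ => β * h)
        (Sum.elim (fun p : TorusSite d N × TorusSite d N => {p.1} ∆ {p.2}) fun a => {a}) σ := by
  rw [torusWeight, gksWeight, gksHamiltonian_torus]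

/-- **`⟨F⟩_{𝕋_N,c,h,β} = ⟨F⟩_{ν_{Λ;K}}`** with `K` as above. [cite: FriedliVelenik2017, §3.8.1, p. 141] -/
theorem torusExpect_eq_gksExpect (F : SpinConfig (TorusSite d N) → ℝ) :
    torusExpect c β h F =
      gksExpect (univ : Finset ((TorusSite d N × TorusSite d N) ⊕ TorusSite d N))
        (Sum.elim (fun p : TorusSite d N × TorusSite d N => β / 2 * c p.1 p.2) fun _ => β * h)
        (Sum.elim (fun p : TorusSite d N × TorusSite d N => {p.1} ∆ {p.2}) fun a => {a}) F := by
  rw [torusExpect, torusPartition, gksExpect, gksSum, gksSum]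
  simp_rw [torusWeight_eq_gksWeight, one_mul]

omit [NeZero N] in
/-- The couplings are nonnegative for `β, h ≥ 0`, `c ≥ 0`. [folklore] -/
theorem torusGksCoupling_nonneg (hβ : 0 ≤ β) (hh : 0 ≤ h) (hc : ∀ a b, 0 ≤ c a b)
    (i : (TorusSite d N × TorusSite d N) ⊕ TorusSite d N) :
    0 ≤ (Sum.elim (fun p : TorusSite d N × TorusSite d N => β / 2 * c p.1 p.2) fun _ => β * h) i := by
  rcases i with p | a
  · exact mul_nonneg (by positivity) (hc _ _)
  · exact mul_nonneg hβ hh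

/-- **GKS I on the torus**: `⟨σ_A⟩_{𝕋_N,c,h,β} ≥ 0` for `β, h ≥ 0`, `c ≥ 0`.
[cite: FriedliVelenik2017, Thm. 3.49, eq. (3.54), p. 141] -/
theorem torusExpect_spinProduct_nonneg (hβ : 0 ≤ β) (hh : 0 ≤ h) (hc : ∀ a b, 0 ≤ c a b)
    (A : Finset (TorusSite d N)) : 0 ≤ torusExpect c β h (spinProduct A) := by
  rw [torusExpect_eq_gksExpect]
  exact gksExpect_spinProduct_nonneg _ _ _ (fun i _ => torusGksCoupling_nonneg c β h hβ hh hc i) _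

/-- **Griffiths' comparison in the coupling matrix**: `|c'| ≤ c` entrywise gives
`⟨σ_A⟩_{𝕋_N,c',h,β} ≤ ⟨σ_A⟩_{𝕋_N,c,h,β}` (`β, h ≥ 0`). [cite: FriedliVelenik2017, Exercise 3.31, p. 142] -/
theorem torusExpect_spinProduct_mono_coupling (hβ : 0 ≤ β) (hh : 0 ≤ h) {c' : TorusSite d N → TorusSite d N → ℝ}
    (hcc' : ∀ a b, |c' a b| ≤ c a b) (A : Finset (TorusSite d N)) :
    torusExpect c' β h (spinProduct A) ≤ torusExpect c β h (spinProduct A) := by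
  rw [torusExpect_eq_gksExpect, torusExpect_eq_gksExpect]
  refine gksExpect_mono_of_abs_le _ _ (fun i _ => ?_) _
  rcases i with p | a
  · simp only [Sum.elim_inl]
    rw [abs_mul, abs_of_nonneg (by positivity : (0 : ℝ) ≤ β / 2)]
    exact mul_le_mul_of_nonneg_left (hcc' _ _) (by positivity)
  · simp only [Sum.elim_inr]
    rw [abs_of_nonneg (mul_nonneg hβ hh)]

/-- **Monotonicity in the field**: `⟨σ_A⟩_{𝕋_N,c,h₁,β} ≤ ⟨σ_A⟩_{𝕋_N,c,h₂,β}` for `0 ≤ h₁ ≤ h₂`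
(`β ≥ 0`, `c ≥ 0`). [cite: FriedliVelenik2017, Exercise 3.9, p. 109] -/
theorem torusExpect_spinProduct_mono_field (hβ : 0 ≤ β) (hc : ∀ a b, 0 ≤ c a b) {h₁ h₂ : ℝ}
    (hh₁ : 0 ≤ h₁) (h12 : h₁ ≤ h₂) (A : Finset (TorusSite d N)) :
    torusExpect c β h₁ (spinProduct A) ≤ torusExpect c β h₂ (spinProduct A) := by
  rw [torusExpect_eq_gksExpect, torusExpect_eq_gksExpect]
  refine gksExpect_mono_of_abs_le _ _ (fun i _ => ?_) _
  rcases i with p | a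
  · simp only [Sum.elim_inl]
    rw [abs_of_nonneg (mul_nonneg (by positivity) (hc _ _))]
  · simp only [Sum.elim_inr]
    rw [abs_of_nonneg (mul_nonneg hβ hh₁)]
    exact mul_le_mul_of_nonneg_left h12 hβ

/-! #### Translation invariance and spin-flip symmetry -/

omit [NeZero N] in
/-- `σ_a(σ ∘ ψ) = σ_{ψ a}(σ)`. [folklore] -/
theorem spinAt_comp_torus (ψ : TorusSite d N → TorusSite d N) (σ : SpinConfig (TorusSite d N)) (a : TorusSite d N) :
    spinAt a (σ ∘ ψ) = spinAt (ψ a) σ := rfl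

/-- The Hamiltonian is invariant under a bijection of the torus preserving `c`. [folklore] -/
theorem torusHamiltonian_comp_equiv (ψ : TorusSite d N ≃ TorusSite d N) (hc : ∀ a b, c (ψ a) (ψ b) = c a b)
    (σ : SpinConfig (TorusSite d N)) : torusHamiltonian c h (σ ∘ ψ) = torusHamiltonian c h σ := by
  have h1 : ∀ a, spinAt a (σ ∘ ψ) = spinAt (ψ a) σ := fun a => rfl
  have hB : ∑ a, spinAt (ψ a) σ = ∑ a, spinAt a σ := Equiv.sum_comp ψ (fun a => spinAt a σ)
  have hA : ∑ a, ∑ b, c a b * spinAt (ψ a) σ * spinAt (ψ b) σ = ∑ a, ∑ b, c a b * spinAt a σ * spinAt b σ := by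
    calc ∑ a, ∑ b, c a b * spinAt (ψ a) σ * spinAt (ψ b) σ
        = ∑ a, ∑ b, c (ψ a) (ψ b) * spinAt (ψ a) σ * spinAt (ψ b) σ :=
          Finset.sum_congr rfl fun a _ => Finset.sum_congr rfl fun b _ => by rw [hc]
      _ = ∑ a, ∑ b, c (ψ a) b * spinAt (ψ a) σ * spinAt b σ :=
          Finset.sum_congr rfl fun a _ => Equiv.sum_comp ψ (fun b => c (ψ a) b * spinAt (ψ a) σ * spinAt b σ)
      _ = ∑ a, ∑ b, c a b * spinAt a σ * spinAt b σ :=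
          Equiv.sum_comp ψ (fun a => ∑ b, c a b * spinAt a σ * spinAt b σ)
  simp only [torusHamiltonian, h1]
  rw [hA, hB]

/-- **Covariance of the torus state** under a bijection preserving `c`: `⟨F(σ ∘ ψ)⟩ = ⟨F⟩`.
[cite: FriedliVelenik2017, Exercise 3.14, p. 115] -/
theorem torusExpect_comp_equiv (ψ : TorusSite d N ≃ TorusSite d N) (hc : ∀ a b, c (ψ a) (ψ b) = c a b)
    (F : SpinConfig (TorusSite d N) → ℝ) : torusExpect c β h (fun σ => F (σ ∘ ψ)) = torusExpect c β h F := by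
  set E : SpinConfig (TorusSite d N) ≃ SpinConfig (TorusSite d N) := Equiv.arrowCongr ψ (Equiv.refl ℤˣ) with hE
  have hE' : ∀ σ : SpinConfig (TorusSite d N), E.symm σ = σ ∘ ψ := fun σ => rfl
  have hw : ∀ σ, torusWeight c β h (σ ∘ ψ) = torusWeight c β h σ := fun σ => by
    rw [torusWeight, torusWeight, torusHamiltonian_comp_equiv c h ψ hc]
  rw [torusExpect, torusExpect]
  congr 1
  calc ∑ σ, F (σ ∘ ψ) * torusWeight c β h σ = ∑ σ, (fun τ => F τ * torusWeight c β h τ) (E.symm σ) := by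
        refine Finset.sum_congr rfl fun σ _ => ?_
        simp only [hE']
        rw [hw]
    _ = ∑ τ, F τ * torusWeight c β h τ := Equiv.sum_comp E.symm (fun τ => F τ * torusWeight c β h τ)

/-- **Translation invariance of the torus state on spin products**: if `c_{a+t,b+t} = c_{a,b}` then
`⟨σ_{A+t}⟩_{𝕋_N,c,h,β} = ⟨σ_A⟩_{𝕋_N,c,h,β}`. [cite: FriedliVelenik2017, Exercise 3.14, p. 115] -/
theorem torusExpect_spinProduct_image_addRight (t : TorusSite d N) (hc : ∀ a b, c (a + t) (b + t) = c a b)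
    (A : Finset (TorusSite d N)) :
    torusExpect c β h (spinProduct (A.image (· + t))) = torusExpect c β h (spinProduct A) := by
  have h1 : spinProduct (A.image (· + t)) = fun σ : SpinConfig (TorusSite d N) => spinProduct A (σ ∘ Equiv.addRight t) := by
    funext σ
    rw [spinProduct, spinProduct, Finset.prod_image fun a _ b _ hab => add_right_cancel hab]
    rfl
  rw [h1]
  exact torusExpect_comp_equiv c β h (Equiv.addRight t) hc (spinProduct A)

omit [NeZero N] in
/-- `σ_a(-σ) = -σ_a(σ)`. [folklore] -/
theorem spinAt_neg_torus (σ : SpinConfig (TorusSite d N)) (a : TorusSite d N) : spinAt a (-σ) = -spinAt a σ := by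
  simp [spinAt, Units.val_neg]

/-- At zero field the Hamiltonian is even under the global spin flip. [folklore] -/
theorem torusHamiltonian_zero_neg (σ : SpinConfig (TorusSite d N)) : torusHamiltonian c 0 (-σ) = torusHamiltonian c 0 σ := by
  simp only [torusHamiltonian, spinAt_neg_torus, zero_mul, sub_zero, mul_neg, neg_mul, neg_neg]  -- flip

/-- **Spin-flip symmetry at `h = 0`**: `⟨F(-σ)⟩_{𝕋_N,c,0,β} = ⟨F⟩_{𝕋_N,c,0,β}`. [folklore] -/
theorem torusExpect_comp_neg (F : SpinConfig (TorusSite d N) → ℝ) :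
    torusExpect c β 0 (fun σ => F (-σ)) = torusExpect c β 0 F := by
  have hw : ∀ σ, torusWeight c β 0 (-σ) = torusWeight c β 0 σ := fun σ => by
    rw [torusWeight, torusWeight, torusHamiltonian_zero_neg]
  rw [torusExpect, torusExpect]
  congr 1
  calc ∑ σ, F (-σ) * torusWeight c β 0 σ
      = ∑ σ, (fun τ => F τ * torusWeight c β 0 τ) (Equiv.neg (SpinConfig (TorusSite d N)) σ) := by
        refine Finset.sum_congr rfl fun σ _ => ?_
        simp only [Equiv.neg_apply]
        rw [hw]
    _ = ∑ τ, F τ * torusWeight c β 0 τ := Equiv.sum_comp _ (fun τ => F τ * torusWeight c β 0 τ)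

end TorusGibbs

/-! ### Transport of the free cube model `⟨·⟩_{[0,N)^d,J,h,β}` to the torus -/

section Transport

variable (J : Site d → Site d → ℝ) (N : ℕ) [NeZero N] (β h : ℝ)

/-- The energy of the transported free cube model is the free energy of the cube:
`H_{𝕋_N,cubeCoupling,h}(τ ∘ lift) = H_{[0,N)^d,J,h}(τ·free)`. [folklore] -/
theorem torusHamiltonian_cubeCoupling (τ : SpinConfig ↥(halfOpenBox d N)) :
    torusHamiltonian (cubeCoupling J N) h (τ ∘ (cubeEquivTorus N).symm) =
      pairHamiltonian J (halfOpenBox d N) h (glue (halfOpenBox d N) τ .free) := by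
  set e := cubeEquivTorus (d := d) N with he
  have hs : ∀ a : TorusSite d N, spinAt a (τ ∘ e.symm) = spinAt (e.symm a) τ := fun a => rfl
  have hB : ∑ a : TorusSite d N, spinAt a (τ ∘ e.symm) = ∑ x ∈ halfOpenBox d N, spinAt x (glue (halfOpenBox d N) τ .free) := by
    simp_rw [hs]
    rw [Equiv.sum_comp e.symm (fun z => spinAt z τ), ← Finset.sum_coe_sort (halfOpenBox d N)]
    exact Finset.sum_congr rfl fun z _ => (spinAt_glue_coe τ .free z).symm
  have hA : ∑ a : TorusSite d N, ∑ b : TorusSite d N, cubeCoupling J N a b * spinAt a (τ ∘ e.symm) * spinAt b (τ ∘ e.symm) =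
      ∑ x ∈ halfOpenBox d N, ∑ y ∈ halfOpenBox d N,
        J x y * spinAt x (glue (halfOpenBox d N) τ .free) * spinAt y (glue (halfOpenBox d N) τ .free) := by
    simp_rw [hs]
    have h1 : ∀ a b : TorusSite d N, cubeCoupling J N a b = J ((e.symm a : ↥(halfOpenBox d N)) : Site d) (e.symm b : ↥(halfOpenBox d N)) :=
      fun a b => rfl
    simp_rw [h1]
    rw [Equiv.sum_comp e.symm (fun z : ↥(halfOpenBox d N) => ∑ b : TorusSite d N,
      J (z : Site d) (e.symm b : ↥(halfOpenBox d N)) * spinAt z τ * spinAt (e.symm b) τ)]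
    rw [← Finset.sum_coe_sort (halfOpenBox d N)]
    refine Finset.sum_congr rfl fun z _ => ?_
    rw [Equiv.sum_comp e.symm (fun w : ↥(halfOpenBox d N) => J (z : Site d) (w : Site d) * spinAt z τ * spinAt w τ),
      ← Finset.sum_coe_sort (halfOpenBox d N)]
    refine Finset.sum_congr rfl fun w _ => ?_
    rw [spinAt_glue_coe, spinAt_glue_coe]
  rw [torusHamiltonian, pairHamiltonian, hA, hB]

/-- The weights agree: `exp[-βH_{𝕋_N,cubeCoupling,h}(τ ∘ lift)] = exp[-βH_{[0,N)^d,J,h}(τ·free)]`. [folklore] -/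
theorem torusWeight_cubeCoupling (τ : SpinConfig ↥(halfOpenBox d N)) :
    torusWeight (cubeCoupling J N) β h (τ ∘ (cubeEquivTorus N).symm) = pairGibbsWeight J (halfOpenBox d N) β h τ := by
  rw [torusWeight, pairGibbsWeight, torusHamiltonian_cubeCoupling]

/-- **The free cube state is the transported torus state**:
`⟨F⟩_{[0,N)^d,J,h,β} = ⟨F((σ ∘ proj)·free)⟩_{𝕋_N,cubeCoupling,h,β}`. [folklore] -/
theorem expectIn_halfOpenBox_eq_torusExpect (F : SpinConfig (Site d) → ℝ) :
    expectIn J (halfOpenBox d N) β h F =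
      torusExpect (cubeCoupling J N) β h (fun σ => F (glue (halfOpenBox d N) (σ ∘ cubeEquivTorus N) .free)) := by
  set e := cubeEquivTorus (d := d) N with he
  set E : SpinConfig ↥(halfOpenBox d N) ≃ SpinConfig (TorusSite d N) := Equiv.arrowCongr e (Equiv.refl ℤˣ) with hE
  have hE' : ∀ τ : SpinConfig ↥(halfOpenBox d N), E τ = τ ∘ e.symm := fun τ => rfl
  have hback : ∀ τ : SpinConfig ↥(halfOpenBox d N), (τ ∘ e.symm) ∘ e = τ := by
    intro τ
    funext z
    simp only [Function.comp_apply, Equiv.symm_apply_apply]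
  rw [expectIn, torusExpect, torusPartition]
  congr 1
  · rw [← Equiv.sum_comp E]
    refine Finset.sum_congr rfl fun τ _ => ?_
    rw [hE', hback, torusWeight_cubeCoupling]
  · rw [← Equiv.sum_comp E]
    refine Finset.sum_congr rfl fun τ _ => ?_
    rw [hE', torusWeight_cubeCoupling]

/-- `Torus.proj` is injective on the fundamental cube. [folklore] -/
theorem proj_injOn_halfOpenBox : Set.InjOn (Torus.proj (d := d) N) (halfOpenBox d N : Set (Site d)) := by
  intro x hx y hy hxy
  rw [← torusLift_proj N (Finset.mem_coe.1 hx), ← torusLift_proj N (Finset.mem_coe.1 hy), hxy]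

/-- Spin products transport: `σ_{Ā}(σ) = σ_A((σ ∘ proj)·free)` for `A ⊆ [0,N)^d`, `Ā = proj(A)`. [folklore] -/
theorem spinProduct_image_proj {A : Finset (Site d)} (hA : A ⊆ halfOpenBox d N) (σ : SpinConfig (TorusSite d N)) :
    spinProduct (A.image (Torus.proj N)) σ = spinProduct A (glue (halfOpenBox d N) (σ ∘ cubeEquivTorus N) .free) := by
  rw [spinProduct, spinProduct, Finset.prod_image fun x hx y hy hxy => proj_injOn_halfOpenBox N (hA hx) (hA hy) hxy]
  refine Finset.prod_congr rfl fun x hx => ?_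
  rw [spinAt, spinAt, glue_apply_of_mem _ _ _ (hA hx)]
  rfl

/-- **Transport of spin products**: `⟨σ_A⟩_{[0,N)^d,J,h,β} = ⟨σ_{Ā}⟩_{𝕋_N,cubeCoupling,h,β}` for
`A ⊆ [0,N)^d`. [folklore] -/
theorem expectIn_halfOpenBox_spinProduct_eq {A : Finset (Site d)} (hA : A ⊆ halfOpenBox d N) :
    expectIn J (halfOpenBox d N) β h (spinProduct A) =
      torusExpect (cubeCoupling J N) β h (spinProduct (A.image (Torus.proj N))) := by
  rw [expectIn_halfOpenBox_eq_torusExpect]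
  simp_rw [← spinProduct_image_proj N hA]

/-- **Griffiths' comparison, cube form**: `⟨σ_A⟩^free_{[0,N)^d,J,h,β} ≤ ⟨σ_{Ā}⟩_{𝕋_N,J^{(N)},h,β}`
(`β, h ≥ 0`, `J ≥ 0` translation invariant with `J_{0,·}` summable): the torus state has the larger
couplings `J^{(N)} ≥ J`. [cite: FriedliVelenik2017, Exercise 3.31, p. 142] -/
theorem expectIn_halfOpenBox_spinProduct_le_torusExpect (hβ : 0 ≤ β) (hh : 0 ≤ h) (hJ : ∀ x y, 0 ≤ J x y)
    (hJt : ∀ a x y, J (x + a) (y + a) = J x y) (hJs : Summable (J 0)) {A : Finset (Site d)}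
    (hA : A ⊆ halfOpenBox d N) :
    expectIn J (halfOpenBox d N) β h (spinProduct A) ≤
      torusExpect (torusCoupling J N) β h (spinProduct (A.image (Torus.proj N))) := by
  rw [expectIn_halfOpenBox_spinProduct_eq J N β h hA]
  refine torusExpect_spinProduct_mono_coupling _ β h hβ hh (fun a b => ?_) _
  rw [abs_of_nonneg (cubeCoupling_nonneg J N hJ a b)]
  exact cubeCoupling_le_torusCoupling J N hJ hJt hJs a b

omit [NeZero N] in
/-- `Λ_n ⊆ [0,N)^d - n𝟙` for `2n + 1 ≤ N`. [folklore] -/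
theorem box_subset_halfOpenBox_map {n : ℕ} (hnN : 2 * n + 1 ≤ N) :
    box d n ⊆ (halfOpenBox d N).map (Equiv.addRight (fun _ : Fin d => -(n : ℤ))).toEmbedding := by
  intro x hx
  rw [mem_box] at hx
  rw [Finset.mem_map]
  refine ⟨x + fun _ => (n : ℤ), ?_, ?_⟩
  · rw [mem_halfOpenBox]
    intro i
    simp only [Pi.add_apply]
    constructor <;> [linarith [(hx i).1]; (have := (hx i).2; push_cast at hnN ⊢; linarith)]
  · simp only [Equiv.coe_toEmbedding, Equiv.coe_addRight]
    funext i
    simp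

/-- **Griffiths' comparison of the free box with the torus** (the long-range analogue of ADS15
(3.19) / Friedli–Velenik Exercise 3.31): for `β, h ≥ 0`, `J ≥ 0` translation invariant with
`J_{0,·}` summable, `A ⊆ Λ_n` and `2n + 1 ≤ N`,
`⟨σ_A⟩^free_{Λ_n,J,h,β} ≤ ⟨σ_{Ā}⟩_{𝕋_N,J^{(N)},h,β}`, `Ā = proj(A)`: enlarge `Λ_n` to a translate
of the fundamental cube (volume monotonicity), transport to the torus, compare the couplings
(`J ≤ J^{(N)}`), and use translation invariance of the torus state.
[cite: AizenmanDuminilCopinSidoraviciusCMP2015, §3.3 eq. (3.19)] -/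
theorem expectIn_box_spinProduct_le_torusExpect (hβ : 0 ≤ β) (hh : 0 ≤ h) (hJ : ∀ x y, 0 ≤ J x y)
    (hJt : ∀ a x y, J (x + a) (y + a) = J x y) (hJs : Summable (J 0)) {n : ℕ} (hnN : 2 * n + 1 ≤ N)
    {A : Finset (Site d)} (hA : A ⊆ box d n) :
    expectIn J (box d n) β h (spinProduct A) ≤
      torusExpect (torusCoupling J N) β h (spinProduct (A.image (Torus.proj N))) := by
  have hsub := box_subset_halfOpenBox_map (d := d) N hnN
  set v : Site d := fun _ => -(n : ℤ) with hv
  set A' : Finset (Site d) := A.map (Equiv.addRight (-v)).toEmbedding with hA'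
  have hAA' : A'.map (Equiv.addRight v).toEmbedding = A := by
    rw [hA', Finset.map_map]
    convert Finset.map_refl (s := A)
    ext x
    simp
  -- volume monotonicity, then translation by `-v`
  have h1 : expectIn J (box d n) β h (spinProduct A) ≤ expectIn J (halfOpenBox d N) β h (spinProduct A') := by
    have hmono := expectIn_spinProduct_mono_volume_field J β h hβ hh hJ hA hsub
    rw [← hAA', expectIn_spinProduct_map_addRight J β h v (hJt v) (halfOpenBox d N) A'] at hmono
    rwa [hAA'] at hmono
  have hA'sub : A' ⊆ halfOpenBox d N := by
    intro y hy
    have hy' : y + v ∈ A := by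
      rw [← hAA']
      exact Finset.mem_map_of_mem _ hy
    have hb := hsub (hA hy')
    rw [Finset.mem_map] at hb
    obtain ⟨w, hw, hwy⟩ := hb
    have hwy' : w + v = y + v := by simpa using hwy
    rwa [add_right_cancel hwy'] at hw
  have h2 := expectIn_halfOpenBox_spinProduct_le_torusExpect J N β h hβ hh hJ hJt hJs hA'sub
  -- the image of `A'` is the translate of the image of `A` by `proj (-v)`
  have himg : A'.image (Torus.proj N) = (A.image (Torus.proj N)).image (· + Torus.proj N (-v)) := by
    rw [hA', Finset.map_eq_image, Finset.image_image, Finset.image_image]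
    refine Finset.image_congr fun x _ => ?_
    simp only [Function.comp_apply, Equiv.coe_toEmbedding, Equiv.coe_addRight]
    rw [proj_add_eq]
  have h3 : torusExpect (torusCoupling J N) β h (spinProduct (A'.image (Torus.proj N))) =
      torusExpect (torusCoupling J N) β h (spinProduct (A.image (Torus.proj N))) := by
    rw [himg]
    exact torusExpect_spinProduct_image_addRight _ β h _ (fun a b => torusCoupling_add_right J N hJt a b _) _
  linarith [h1, h2, h3.le, h3.ge]

/-- **The infinite-volume free state is dominated by the torus states**: if along the even tori
`𝕋_N`, `N ≥ N₀`, `⟨σ_{Ā}⟩_{𝕋_N,J^{(N)},h,β} ≤ B`, then `⟨σ_A⟩_{J,h,β} ≤ B` (`β, h ≥ 0`, `J ≥ 0`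
translation invariant, `J_{0,·}` summable): every box `Λ_n` sits in a large even torus.
[cite: AizenmanDuminilCopinSidoraviciusCMP2015, §3.3 eq. (3.19)] -/
theorem state_spinProduct_le_of_torusExpect_le (hβ : 0 ≤ β) (hh : 0 ≤ h) (hJ : ∀ x y, 0 ≤ J x y)
    (hJt : ∀ a x y, J (x + a) (y + a) = J x y) (hJs : Summable (J 0)) (A : Finset (Site d)) {B : ℝ} {N₀ : ℕ}
    (hB : ∀ M : ℕ, [NeZero M] → N₀ ≤ M → Even M →
      torusExpect (torusCoupling J M) β h (spinProduct (A.image (Torus.proj M))) ≤ B) :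
    state J β h (spinProduct A) ≤ B := by
  obtain ⟨n₀, hn₀⟩ := exists_forall_subset_box d A
  refine le_of_tendsto (tendsto_expectIn_box_field J β h hβ hh hJ A) ?_
  filter_upwards [eventually_ge_atTop n₀] with n hn
  set M : ℕ := 2 * max N₀ (n + 1) with hM
  haveI : NeZero M := ⟨by omega⟩
  have h1 := expectIn_box_spinProduct_le_torusExpect J M β h hβ hh hJ hJt hJs
    (show 2 * n + 1 ≤ M by omega) (hn₀ n hn)
  exact h1.trans (hB M (by omega) ⟨max N₀ (n + 1), by omega⟩)

end Transport

end LongRangeIsing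

end Literature.Barriers.CriticalPhenomena
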